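import Mathlib
import HarnessLib

/-!
# Connes–Consani–Moscovici 2024, §5.2 «Metaplectic representation and orthogonal polynomials», I:
# the Jacobi matrix `A`, the grading `N`, `F_±`, and Lemma 5.1 — PROVED

LINE 1 — FRAMING: RH-FREE corpus literature (orthogonal-polynomial / representation-theoretic identities behind
the prolate wave operator; no positivity statement; nothing here bears on the truth of RH); cell rh-crit, corpus
C1 (Connes–Consani), typer t14; bears_on: W-C/W-P (sequel, no leaf role).  WHAT THIS IS NOT: any claim about RH,
any new conjecture, any route.

Source: A. Connes, C. Consani, H. Moscovici, *Zeta zeros and prolate wave operators*, Ann. Funct. Anal. 15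
(2024) = arXiv:2310.18423 [bib: `ConnesConsaniMoscovici2024`], §5.2, held text `paper:arxiv-2310.18423` (tex
chunks; locators `pNNNN:Lnn` = chunk:line; equation labels are quoted as they appear in the held tex, e.g.
«(eplusminus)»).  Companion files: `ProlateWaveMetaplecticSl2.lean` (the representation `σ`, «(aak)» ⟺
«(diffsqan)», Theorem 5.2 (i)), `ProlateWaveMoments.lean` (moments, Theorem 5.2 (ii)–(iii), the closing
Proposition), `ProlateWaveMetaplecticRepresentation.lean` (§5.1, the operators `ϖ(h), ϖ(e_±), ϖ(k)` on `𝒮`).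

## What is printed and how it is typed

"At the formal level" (p0007:L68, p0017:L56) an even cyclic pair is the Jacobi matrix `A` («(matrixA)»,
p0017:L69: symmetric, zero diagonal, `A_{n,n+1} = A_{n+1,n} = a_n > 0`) with the grading `N P_n = n P_n`
(p0017:L104).  We realise such column-finite matrices as `ℂ`-linear endomorphisms of the space `ℕ → ℂ` of ALL
column vectors (coordinates in the orthonormal basis `(ξ_n) = (P_n)`; a banded matrix acts on every column
vector; `T_{m,n} = (T ξ_n) m`, `ξ_n = Pi.single n 1`).  `[X,Y] := XY − YX` is the plain `def comm` (no
Lie-bracket instance is declared).  The coefficients `a_n` are arbitrary complex numbers in this file.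

| print | Lean | status |
|---|---|---|
| `A` «(matrixA)» p0017:L69; `N` p0017:L104 | `jacobi a = superDiag a + subDiag a`; `grading` | defs |
| `F_± := N ± (1/2i)[A,N]` «(eplusminus)» p0017:L107 | `fPlus a`, `fMinus a` | defs |
| `[A,N]` = the displayed matrix «(comm)» p0017:L145 | `comm_jacobi_grading` | PROVED |
| **Lemma 5.1 (i)** `[[A,N],N] = A` p0017:L111 | `lemma_5_1_i` | PROVED |
| **Lemma 5.1 (ii)** `[F₊,F₋] = −iA` p0017:L113 | `lemma_5_1_ii` | PROVED |
| **Lemma 5.1 (iii)** `[A,[A,N]] = f(N)`, `f(n) = 2(a_{n−1}² − a_n²)` p0017:L115–L119 | `fSeq`, `lemma_5_1_iii` | PROVED |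
| **Lemma 5.1 (iv)** `[A,F₊] = 2iF₊ + Υ`, `(1/i)d_n = −2n + a_n² − a_{n−1}²` «(dn)» p0017:L121–L125, `d_n = −2in + (1/2i)f(n)` p0018:L2 | `dSeq`, `lemma_5_1_iv`, `dSeq_spec` | PROVED |
| **Lemma 5.1 (v)** `F₊ − ½iA = N − i𝒮` upper triangular, `𝒮` the weighted shift p0017:L127–L140 | `lemma_5_1_v`, `lemma_5_1_v_upper` (`𝒮 = superDiag a`) | PROVED |
| `a_n = ½√((2n+1)(2n+2))` «(coefffixed)» p0018:L65 (= §3.4, p0010:L98) | `metaA`, `metaA_sq` | def, PROVED |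

Convention: `a_{−1} = 0` (`aPrev`), read off the displayed matrices (first diagonal entry of `[A,[A,N]]` is
`−2a_0²`, p0017:L168).

## References

* [ConnesConsaniMoscovici2024] A. Connes, C. Consani, H. Moscovici, *Zeta zeros and prolate wave operators*,
  Ann. Funct. Anal. 15 (2024), doi:10.1007/s43034-024-00388-z, arXiv:2310.18423, §5.2 Lemma 5.1.
-/


noncomputable section

open Complex

namespace Literature.NumberTheory.ConnesConsani2024

/-! ## Column-finite matrices on `ℕ → ℂ` -/

section Matrices

/-- The diagonal matrix with entries `d n` acting on column vectors `v : ℕ → ℂ`. [folklore] -/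
def diagOp (d : ℕ → ℂ) : Module.End ℂ (ℕ → ℂ) where
  toFun v n := d n * v n
  map_add' v w := by ext n; simp [mul_add]
  map_smul' c v := by ext n; simp [mul_left_comm]

/-- The matrix with entries `w n` on the SUPER-diagonal, `T_{n,n+1} = w n` (so `T ξ_{n+1} = w_n ξ_n`):
`(T v) n = w n · v (n+1)`.  With `w = a` this is the weighted shift `𝒮` of Lemma 5.1 (v) (p0017:L130).
[cite: ConnesConsaniMoscovici2024, Lemma 5.1 (v) p0017:L127] -/
def superDiag (w : ℕ → ℂ) : Module.End ℂ (ℕ → ℂ) where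
  toFun v n := w n * v (n + 1)
  map_add' v u := by ext n; simp [mul_add]
  map_smul' c v := by ext n; simp [mul_left_comm]

/-- The matrix with entries `w n` on the SUB-diagonal, `T_{n+1,n} = w n` (so `T ξ_n = w_n ξ_{n+1}`):
`(T v) 0 = 0`, `(T v) (n+1) = w n · v n`. [folklore] -/
def subDiag (w : ℕ → ℂ) : Module.End ℂ (ℕ → ℂ) where
  toFun v n := match n with
    | 0 => 0
    | m + 1 => w m * v m
  map_add' v u := by ext n; cases n <;> simp [mul_add]
  map_smul' c v := by ext n; cases n <;> simp [mul_left_comm]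

/-- The commutator `[X, Y] := XY − YX` of two formal matrices (p0017:L107). [folklore] -/
def comm (X Y : Module.End ℂ (ℕ → ℂ)) : Module.End ℂ (ℕ → ℂ) := X * Y - Y * X

variable (d w : ℕ → ℂ) (v : ℕ → ℂ) (X Y Z : Module.End ℂ (ℕ → ℂ)) (t : ℂ)

/-- Entries of a diagonal matrix (`Υ` "has the entries `d_n`", p0017:L121): `(diag(d) v)_n = d_n v_n`.
[cite: ConnesConsaniMoscovici2024, Lemma 5.1 (iv) p0017:L121] -/
@[simp] theorem diagOp_apply (n : ℕ) : diagOp d v n = d n * v n := rfl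
/-- Entries of the weighted shift `𝒮` (p0017:L130): `(𝒮 v)_n = a_n v_{n+1}`.
[cite: ConnesConsaniMoscovici2024, Lemma 5.1 (v) p0017:L130] -/
@[simp] theorem superDiag_apply (n : ℕ) : superDiag w v n = w n * v (n + 1) := rfl
/-- Entries of the transposed weighted shift (lower part of «(matrixA)», p0017:L69), row `0`.
[cite: ConnesConsaniMoscovici2024, §5.2 eq. (matrixA) p0017:L69] -/
@[simp] theorem subDiag_apply_zero : subDiag w v 0 = 0 := rfl
/-- Entries of the transposed weighted shift (lower part of «(matrixA)», p0017:L69), row `n+1`.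
[cite: ConnesConsaniMoscovici2024, §5.2 eq. (matrixA) p0017:L69] -/
@[simp] theorem subDiag_apply_succ (n : ℕ) : subDiag w v (n + 1) = w n * v n := rfl
/-- The commutator acts as `[X,Y]v = X(Yv) − Y(Xv)` (p0017:L107). [cite: ConnesConsaniMoscovici2024, §5.2 eq. (eplusminus) p0017:L107] -/
@[simp] theorem comm_apply : comm X Y v = X (Y v) - Y (X v) := rfl

/-- Bilinearity of the commutator (plumbing). [folklore] -/
private theorem comm_add_right : comm X (Y + Z) = comm X Y + comm X Z :=
  LinearMap.ext fun v => by simp; abel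
/-- Bilinearity of the commutator (plumbing). [folklore] -/
private theorem comm_sub_right : comm X (Y - Z) = comm X Y - comm X Z :=
  LinearMap.ext fun v => by simp; abel
/-- Bilinearity of the commutator (plumbing). [folklore] -/
private theorem comm_smul_right : comm X (t • Y) = t • comm X Y :=
  LinearMap.ext fun v => by simp [smul_sub]

end Matrices

/-! ## §5.2: the Jacobi matrix `A`, the grading `N`, `F_±`, and Lemma 5.1 -/

section Jacobi

variable (a : ℕ → ℂ)

/-- The Jacobi matrix `A` of multiplication by `s` for an even measure, «(matrixA)» p0017:L69: zero diagonal,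
`A_{n,n+1} = A_{n+1,n} = a_n`; `A ξ_n = a_n ξ_{n+1} + a_{n−1} ξ_{n−1}`.
[cite: ConnesConsaniMoscovici2024, §5.2 eq. (matrixA) p0017:L69] -/
def jacobi : Module.End ℂ (ℕ → ℂ) := superDiag a + subDiag a

/-- The grading operator `N`, `N P_n = n P_n` (p0017:L104). [cite: ConnesConsaniMoscovici2024, §5.2 p0017:L104] -/
def grading : Module.End ℂ (ℕ → ℂ) := diagOp (fun n => (n : ℂ))

/-- `F₊ := N + (1/2i)[A,N]` «(eplusminus)». [cite: ConnesConsaniMoscovici2024, §5.2 eq. (eplusminus) p0017:L107] -/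
def fPlus : Module.End ℂ (ℕ → ℂ) := grading + (2 * I)⁻¹ • comm (jacobi a) grading

/-- `F₋ := N − (1/2i)[A,N]` «(eplusminus)». [cite: ConnesConsaniMoscovici2024, §5.2 eq. (eplusminus) p0017:L107] -/
def fMinus : Module.End ℂ (ℕ → ℂ) := grading - (2 * I)⁻¹ • comm (jacobi a) grading

/-- The convention `a_{−1} = 0`: `aPrev a n = a_{n−1}`, `aPrev a 0 = 0` (first diagonal entry of `[A,[A,N]]` is
`−2a_0²`, p0017:L168). [cite: ConnesConsaniMoscovici2024, Lemma 5.1 (iii) p0017:L168] -/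
def aPrev : ℕ → ℂ
  | 0 => 0
  | n + 1 => a n

/-- `f(n) = 2(a_{n−1}² − a_n²)` (Lemma 5.1 (iii), p0017:L118; `a_{−1} = 0`).
[cite: ConnesConsaniMoscovici2024, Lemma 5.1 (iii) p0017:L118] -/
def fSeq (n : ℕ) : ℂ := 2 * (aPrev a n ^ 2 - a n ^ 2)

/-- `d_n = −2in + (1/2i) f(n)` (proof of Lemma 5.1 (iv), p0018:L2); the form «(dn)» is `dSeq_spec`.
[cite: ConnesConsaniMoscovici2024, Lemma 5.1 (iv) p0018:L2] -/
def dSeq (n : ℕ) : ℂ := -2 * I * n + (2 * I)⁻¹ * fSeq a n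

/-- `1/(2i) = −i/2` (plumbing). [folklore] -/
private theorem inv_two_I : (2 * I : ℂ)⁻¹ = -I / 2 := by
  rw [mul_inv, Complex.inv_I]; ring

/-- `[A,N] ξ_n = a_{n−1} ξ_{n−1} − a_n ξ_{n+1}` (the matrix «(comm)», p0017:L145): `[A,N] = 𝒮 − 𝒮ᵗ`.
[cite: ConnesConsaniMoscovici2024, Lemma 5.1 proof (i) p0017:L142] -/
theorem comm_jacobi_grading : comm (jacobi a) grading = superDiag a - subDiag a := by
  refine LinearMap.ext fun v => funext fun n => ?_
  rcases n with _ | n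
  · simp [jacobi, grading]
  · simp [jacobi, grading]; ring

/-- **Lemma 5.1 (i)**: `[[A,N],N] = A`. [cite: ConnesConsaniMoscovici2024, Lemma 5.1 (i) p0017:L111] -/
theorem lemma_5_1_i : comm (comm (jacobi a) grading) grading = jacobi a := by
  rw [comm_jacobi_grading]
  refine LinearMap.ext fun v => funext fun n => ?_
  rcases n with _ | n
  · simp [jacobi, grading]
  · simp [jacobi, grading]; ring

/-- **Lemma 5.1 (ii)**: `[F₊,F₋] = −iA`. [cite: ConnesConsaniMoscovici2024, Lemma 5.1 (ii) p0017:L113] -/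
theorem lemma_5_1_ii : comm (fPlus a) (fMinus a) = (-I) • jacobi a := by
  rw [fPlus, fMinus, comm_jacobi_grading, inv_two_I]
  refine LinearMap.ext fun v => funext fun n => ?_
  rcases n with _ | _ | n
  · simp [jacobi, grading]; ring
  · simp [jacobi, grading]; ring
  · simp [jacobi, grading]; ring

/-- **Lemma 5.1 (iii)**: `[A,[A,N]] = f(N)`, the diagonal matrix with entries `f(n) = 2(a_{n−1}² − a_n²)`.
[cite: ConnesConsaniMoscovici2024, Lemma 5.1 (iii) p0017:L115] -/
theorem lemma_5_1_iii : comm (jacobi a) (comm (jacobi a) grading) = diagOp (fSeq a) := by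
  rw [comm_jacobi_grading]
  refine LinearMap.ext fun v => funext fun n => ?_
  rcases n with _ | _ | n
  · simp [jacobi, fSeq, aPrev]; ring
  · simp [jacobi, fSeq, aPrev]; ring
  · simp [jacobi, fSeq, aPrev]; ring

/-- **Lemma 5.1 (iv)**: `[A,F₊] = 2iF₊ + Υ`, `Υ` diagonal with entries `d_n`.
[cite: ConnesConsaniMoscovici2024, Lemma 5.1 (iv) p0017:L121] -/
theorem lemma_5_1_iv : comm (jacobi a) (fPlus a) = (2 * I) • fPlus a + diagOp (dSeq a) := by
  rw [fPlus, comm_add_right, comm_smul_right, lemma_5_1_iii, inv_two_I]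
  generalize comm (jacobi a) grading = B
  refine LinearMap.ext fun v => funext fun n => ?_
  simp [grading, dSeq]
  linear_combination (B v n) * I_sq

/-- The computation of Lemma 5.1 (iv) (p0018:L2) run for `F₋`: `[A,F₋] = [A,N] − (1/2i)[A,[A,N]] = [A,N] − (1/2i) f(N)`.
[cite: ConnesConsaniMoscovici2024, Lemma 5.1 (iv) proof p0018:L2] -/
theorem comm_jacobi_fMinus :
    comm (jacobi a) (fMinus a) = comm (jacobi a) grading - (2 * I)⁻¹ • diagOp (fSeq a) := by
  rw [fMinus, comm_sub_right, comm_smul_right, lemma_5_1_iii]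

/-- «(dn)»: `(1/i) d_n = −2n + a_n² − a_{n−1}²` (`a_{−1} = 0`).
[cite: ConnesConsaniMoscovici2024, Lemma 5.1 (iv) eq. (dn) p0017:L124] -/
theorem dSeq_spec (n : ℕ) : I⁻¹ * dSeq a n = -2 * n + a n ^ 2 - aPrev a n ^ 2 := by
  simp only [dSeq, fSeq, inv_two_I, Complex.inv_I]
  linear_combination (2 * (n : ℂ) + aPrev a n ^ 2 - a n ^ 2) * I_sq

/-- **Lemma 5.1 (v)**: `F₊ − ½iA = N − i𝒮`, `𝒮` the weighted shift with super-diagonal entries `a_n`.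
[cite: ConnesConsaniMoscovici2024, Lemma 5.1 (v) p0017:L127] -/
theorem lemma_5_1_v : fPlus a - (I / 2) • jacobi a = grading - I • superDiag a := by
  rw [fPlus, comm_jacobi_grading, inv_two_I]
  refine LinearMap.ext fun v => funext fun n => ?_
  rcases n with _ | n
  · simp [jacobi, grading]; ring
  · simp [jacobi, grading]; ring

/-- "Upper triangular" for a formal matrix `T` (Lemma 5.1 (v), p0017:L127): `T_{m,n} = (T ξ_n) m = 0` for `m > n`.
[cite: ConnesConsaniMoscovici2024, Lemma 5.1 (v) p0017:L127] -/
def IsUpperTriangular (T : Module.End ℂ (ℕ → ℂ)) : Prop := ∀ n m : ℕ, n < m → T (Pi.single n 1) m = 0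

/-- **Lemma 5.1 (v)**, first clause: `F₊ − ½iA` is upper triangular.
[cite: ConnesConsaniMoscovici2024, Lemma 5.1 (v) p0017:L127] -/
theorem lemma_5_1_v_upper : IsUpperTriangular (fPlus a - (I / 2) • jacobi a) := by
  rw [lemma_5_1_v]
  intro n m hnm
  have h1 : (Pi.single n (1 : ℂ) : ℕ → ℂ) m = 0 := Pi.single_eq_of_ne' hnm.ne _
  have h2 : (Pi.single n (1 : ℂ) : ℕ → ℂ) (m + 1) = 0 := Pi.single_eq_of_ne' (by omega) _
  simp [grading, h1, h2]

end Jacobi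

/-! ## The archimedean coefficients «(coefffixed)» -/

section Coefficients

/-- The positive coefficients `a_n = ½√((2n+1)(2n+2))` «(coefffixed)» (Thm 5.2 (i), p0018:L65) — the Jacobi
coefficients of the archimedean cyclic pair `(S, ξ_∞)` after a change of phase (§3.4, p0010:L98:
`a_n = √((n+½)(n+1))`). [cite: ConnesConsaniMoscovici2024, Thm 5.2 (i) eq. (coefffixed) p0018:L65] -/
def metaA (n : ℕ) : ℝ := 1 / 2 * Real.sqrt ((2 * n + 1) * (2 * n + 2))

/-- "The positive coefficients `a_n`" (Thm 5.2 (i), p0018:L62): `metaA n > 0`.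
[cite: ConnesConsaniMoscovici2024, Thm 5.2 (i) p0018:L62] -/
theorem metaA_pos (n : ℕ) : 0 < metaA n := by
  unfold metaA; positivity

/-- `a_n² = ¼(2n+1)(2n+2)` (p0018:L97). [cite: ConnesConsaniMoscovici2024, §5.2 p0018:L97] -/
theorem metaA_sq (n : ℕ) : metaA n ^ 2 = (2 * n + 1) * (2 * n + 2) / 4 := by
  rw [metaA, mul_pow, Real.sq_sqrt (by positivity)]; ring

end Coefficients

end Literature.NumberTheory.ConnesConsani2024
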